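import Literature.Analysis.FluidPDE.PeriodicCylinderNeumannGradient
import Literature.Analysis.FluidPDE.IteratedSliceDerivatives
import HarnessLib

/-!
# Word derivatives within the closed cylinder versus the tree's Sobolev norms on the period cell

Topic `Literature/Analysis/FluidPDE`. Infrastructure (all results proved) for the discharge of
the pressure estimate `Literature.Analysis.FluidPDE.Ferrari1993_periodicCylinderPressureEstimate`
(Ferrari 1993, Lemma 2; the standard `H^s` estimate of the Neumann problem (10)–(12), p. 281). The
Neumann estimates on the period cell (`PeriodicCylinderNeumannTangential.lean`,
`PeriodicCylinderNeumannGradient.lean`) are stated with `L²(cell)` sizes (`cellL2`) of word derivatives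
within the closed cylinder (`cylWord`) along the rotation generator `J = x₀∂₁ − x₁∂₀` and constant
fields, whereas the named fact and its data estimates (`Ferrari1993PressureEstimateReduction.lean`,
`Ferrari1993PressureProductEstimates.lean`) use the tree's sum-form Sobolev norms
`eSobolevDomainNorm k 2 (cylinderCell L) volume` (sums over the words in the basis
`(eᵢ) = Module.finBasis ℝ ℝ³` of the `L²(cell)` norms of the classical iterated derivatives
`iterDeriv`). This file bridges the two:

* `jcField`/`jcWord` — words over the alphabet `{J} ∪ {constant fields}` (encoded by
  `Option ℝ³`: `none` = `J`, `some v` = the constant field `v`); `constWord v`, the word of constant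
  letters of `v : Fin m → ℝ³` (innermost letter `v 0`, as for `iterDeriv`);
* `cylWord_constWord_eqOn_iterDeriv` — on the open cylinder the word derivative within along
  `constWord v` **is** the classical iterated derivative `iterDeriv m v`;
* `toReal_eSobolevDomainNorm_eq_wordSum` — for `h` smooth on the closed cylinder,
  `‖h‖_{W^{n,2}(cell)} = Σ_{m ≤ n} Σ_{w : Fin m → ι} cellL2 (cylWord (constWord (e ∘ w)) h)`
  (word expansion of the tree norm, `eSobolevDomainNorm_eq_sum_iterDeriv`);
* `exists_cellL2_cylWord_jcWord_le` — **words over `{J} ∪ {constants of norm ≤ M}` are controlled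
  by the Sobolev norm**: for every length `n` there is `K` with
  `cellL2 (cylWord wd h) ≤ K Mⁿ Σ_{m ≤ n} Σ_w cellL2 (cylWord (constWord (e ∘ w)) h)` for all such
  words `wd` of length `n` and all `h` smooth on the closed cylinder (`M ≥ 1` dominating the basis
  vectors). Proof by induction on the word: the outermost letter `X` is expanded pointwise in the
  basis, `∂_X = Σ_k ℓ_k(X(x)) ∂_{e_k}` with `|ℓ_k(X(x))| ≤ ‖ℓ_k‖ M` on `{r ≤ 1}` (`‖J x‖ = r ≤ 1`),
  and the constant derivative `∂_{e_k}` is pushed inside the remaining word at the cost of the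
  commutators `[∂_w, J] = ∂_{Jw}`, `[∂_w, ∂_v] = 0` (`cylDeriv_const_cylWord_jcWord`), which replace
  one letter `J` by the constant letter `Jw` (`‖Jw‖ ≤ ‖w‖`).

All statements are folklore calculus (chain/Leibniz rules for iterated directional derivatives).

Mathlib/tree search: word calculus within the closed cylinder: `PeriodicCylinderWithinCalculus.lean`
(`cylWord`, `cylDeriv_comm_sub`, `cylDeriv_finset_sum`, `norm_rotGen_eq_cylRadius`); tangential words
`tanWord` (`PeriodicCylinderNeumannTangential.lean`) are `jcWord`s (`tanWord_eq_jcWord`); iterated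
classical derivatives `iterDeriv`, `eSobolevDomainNorm_eq_sum_iterDeriv`, `sum_fin_succ_fun`
(`IteratedSliceDerivatives.lean`). From Mathlib: `List.ofFn_succ`, `List.set`, `List.getD`,
`Module.Basis.sum_repr`, `ENNReal.toReal_sum`.
-/

noncomputable section

open MeasureTheory Set Function Filter Topology TopologicalSpace WithLp Metric
open scoped ContDiff NNReal ENNReal InnerProductSpace RealInnerProductSpace

namespace Literature.Analysis.FluidPDE

open Literature.Analysis.FunctionSpaces

/-- Local notation for physical space `ℝ³ = EuclideanSpace ℝ (Fin 3)`. -/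
local notation "ℝ³" => EuclideanSpace ℝ (Fin 3)

/-- Local notation for the closed unit cylinder `{r ≤ 1}`. -/
local notation "𝕂" => closure (SetLike.coe unitCylinder : Set (EuclideanSpace ℝ (Fin 3)))

variable {F : Type*} [NormedAddCommGroup F] [NormedSpace ℝ F]

/-! ### The alphabet `{J} ∪ {constants}` -/

/-- The field of a letter: `none` is the rotation generator `J`, `some v` the constant field `v`.
[folklore] -/
def jcField : Option ℝ³ → (ℝ³ → ℝ³)
  | none => rotGen
  | some v => fun _ => v

/-- The fields of a word over `{J} ∪ {constants}`. [folklore] -/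
def jcWord (wd : List (Option ℝ³)) : List (ℝ³ → ℝ³) := wd.map jcField

/-- The word of constant letters of `v : Fin m → ℝ³`, innermost letter `v 0` (the order of
`iterDeriv m v`). [folklore] -/
def constWord {m : ℕ} (v : Fin m → ℝ³) : List (Option ℝ³) := ((List.ofFn v).reverse).map some

/-- Unfolding the letter `J`. [folklore] -/
@[simp] theorem jcField_none : jcField none = rotGen := rfl

/-- Unfolding a constant letter. [folklore] -/
@[simp] theorem jcField_some (v : ℝ³) : jcField (some v) = fun _ => v := rfl

/-- The empty word. [folklore] -/
@[simp] theorem jcWord_nil : jcWord [] = [] := rfl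

/-- Unfolding a word on a cons. [folklore] -/
@[simp] theorem jcWord_cons (X : Option ℝ³) (wd : List (Option ℝ³)) :
    jcWord (X :: wd) = jcField X :: jcWord wd := rfl

/-- Words of a concatenation. [folklore] -/
theorem jcWord_append (wd wd' : List (Option ℝ³)) : jcWord (wd ++ wd') = jcWord wd ++ jcWord wd' := by
  simp [jcWord]

/-- The length of a word. [folklore] -/
@[simp] theorem length_jcWord (wd : List (Option ℝ³)) : (jcWord wd).length = wd.length := by
  simp [jcWord]

/-- The empty word of constants. [folklore] -/
@[simp] theorem constWord_zero (v : Fin 0 → ℝ³) : constWord v = [] := by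
  simp [constWord]

/-- One more (innermost) letter: `constWord (cons a v) = constWord v ++ [a]`. [folklore] -/
theorem constWord_cons {m : ℕ} (a : ℝ³) (v : Fin m → ℝ³) :
    constWord (Fin.cons a v : Fin (m + 1) → ℝ³) = constWord v ++ [some a] := by
  simp only [constWord, List.ofFn_succ, Fin.cons_zero, Fin.cons_succ, List.reverse_cons, List.map_append,
    List.map_cons, List.map_nil]

/-- The length of a word of constants. [folklore] -/
@[simp] theorem length_constWord {m : ℕ} (v : Fin m → ℝ³) : (constWord v).length = m := by
  simp [constWord]

/-- The letters are smooth. [folklore] -/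
theorem contDiff_jcField : ∀ X : Option ℝ³, ContDiff ℝ ∞ (jcField X)
  | none => contDiff_rotGen
  | some _ => contDiff_const

/-- Word derivatives over the alphabet of functions smooth on the closed cylinder are smooth there.
[folklore] -/
theorem contDiffOn_cylWord_jcWord (wd : List (Option ℝ³)) {f : ℝ³ → F} (hf : ContDiffOn ℝ ∞ f 𝕂) :
    ContDiffOn ℝ ∞ (cylWord (jcWord wd) f) 𝕂 :=
  contDiffOn_cylWord (fun V hV => by
    obtain ⟨X, -, rfl⟩ := List.mem_map.1 hV
    exact contDiff_jcField X) hf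

/-- The letters are bounded on the closed cylinder: `‖J x‖ = r ≤ 1`, `‖v‖ ≤ M`. [folklore] -/
theorem norm_jcField_le {M : ℝ} (hM : 1 ≤ M) : ∀ {X : Option ℝ³}, (∀ v, X = some v → ‖v‖ ≤ M) →
    ∀ {x : ℝ³}, x ∈ 𝕂 → ‖jcField X x‖ ≤ M
  | none, _, x, hx => by
    rw [jcField_none, norm_rotGen_eq_cylRadius]
    rw [closure_unitCylinder] at hx
    exact le_trans hx hM
  | some v, hv, _, _ => hv v rfl

/-- The tangential words of `PeriodicCylinderNeumannTangential` are words over the alphabet: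
`tanField b = jcField (if b then none else some e₂)`. [folklore] -/
theorem tanWord_eq_jcWord (β : List Bool) :
    tanWord β = jcWord (β.map fun b => if b then none else some (cylBasis 2)) := by
  induction β with
  | nil => rfl
  | cons b β ih =>
    rw [tanWord_cons, List.map_cons, jcWord_cons, ih]
    cases b <;> rfl

/-! ### Constant words are classical iterated derivatives on the open cylinder -/

/-- **On the open cylinder, the word derivative within along `constWord v` is `iterDeriv m v`**
(for functions agreeing on the open cylinder). [folklore] -/
theorem cylWord_constWord_eqOn_iterDeriv : ∀ (m : ℕ) (v : Fin m → ℝ³) {g₁ g₂ : ℝ³ → F},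
    EqOn g₁ g₂ (unitCylinder : Set ℝ³) →
      EqOn (cylWord (jcWord (constWord v)) g₁) (iterDeriv m v g₂) (unitCylinder : Set ℝ³)
  | 0, v, g₁, g₂, h => by
    rw [constWord_zero, jcWord_nil, cylWord_nil, iterDeriv_zero]
    exact h
  | m + 1, v, g₁, g₂, h => by
    have hv : v = Fin.cons (v 0) (Fin.tail v) := (Fin.cons_self_tail v).symm
    rw [hv, constWord_cons, ← hv, jcWord_append, cylWord_append, iterDeriv_succ]
    refine cylWord_constWord_eqOn_iterDeriv m (Fin.tail v) fun x hx => ?_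
    show cylDeriv (jcField (some (v 0))) g₁ x = fderiv ℝ g₂ x (v 0)
    rw [jcField_some, cylDeriv_eq_fderiv _ _ hx,
      (eventuallyEq_of_mem (unitCylinder.isOpen.mem_nhds hx) h).fderiv_eq]

/-- The word derivative within along a constant word, read on the open cylinder. [folklore] -/
theorem cylWord_constWord_eqOn_iterDeriv' (m : ℕ) (v : Fin m → ℝ³) (g : ℝ³ → F) :
    EqOn (cylWord (jcWord (constWord v)) g) (iterDeriv m v g) (unitCylinder : Set ℝ³) :=
  cylWord_constWord_eqOn_iterDeriv m v fun _ _ => rfl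

/-! ### The word sum of the Sobolev norm -/

section WordSum

variable [CompleteSpace F]

/-- **Word expansion of the tree's Sobolev norm with derivatives within the closed cylinder**: for
`h` smooth on `{r ≤ 1}`, `‖h‖_{W^{n,2}(cell)}` is the (finite) sum over `m ≤ n` and the words
`w : Fin m → ι` in the basis `e = Module.finBasis ℝ ℝ³` of `cellL2 (cylWord (constWord (e ∘ w)) h)`.
[folklore] -/
theorem toReal_eSobolevDomainNorm_eq_wordSum (L : ℝ) (n : ℕ) {h : ℝ³ → F} (hh : ContDiffOn ℝ ∞ h 𝕂) :
    (eSobolevDomainNorm n 2 (cylinderCell L) volume h).toReal =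
      ∑ m ∈ Finset.range (n + 1), ∑ w : Fin m → Fin (Module.finrank ℝ ℝ³),
        cellL2 L (cylWord (jcWord (constWord fun j => Module.finBasis ℝ ℝ³ (w j))) h) := by
  have hΩU : (cylinderCell L : Set ℝ³) ⊆ (unitCylinder : Set ℝ³) := cylinderCell_le_unitCylinder L
  have hΩm : MeasurableSet (cylinderCell L : Set ℝ³) := (cylinderCell L).isOpen.measurableSet
  have hhΩ : ContDiffOn ℝ ∞ h (cylinderCell L : Set ℝ³) := hh.mono (subset_closure.trans (closure_cylinderCell_subset L))
  rw [eSobolevDomainNorm_eq_sum_iterDeriv 2 n hhΩ]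
  -- each term is the `L²` norm of the word derivative within, and is finite
  have hterm : ∀ (m : ℕ) (w : Fin m → Fin (Module.finrank ℝ ℝ³)),
      eLpNorm (iterDeriv m (fun j => Module.finBasis ℝ ℝ³ (w j)) h) 2 (volume.restrict (cylinderCell L : Set ℝ³)) =
        eLpNorm (cylWord (jcWord (constWord fun j => Module.finBasis ℝ ℝ³ (w j))) h) 2
          (volume.restrict (cylinderCell L : Set ℝ³)) := fun m w =>
    (eLpNorm_congr_ae (ae_restrict_of_forall_mem hΩm fun x hx =>
      cylWord_constWord_eqOn_iterDeriv' m _ h (hΩU hx))).symm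
  have hfin : ∀ (m : ℕ) (w : Fin m → Fin (Module.finrank ℝ ℝ³)),
      eLpNorm (cylWord (jcWord (constWord fun j => Module.finBasis ℝ ℝ³ (w j))) h) 2
          (volume.restrict (cylinderCell L : Set ℝ³)) ≠ ⊤ := fun m w =>
    (memLp_two_cylinderCell_of_continuousOn L (contDiffOn_cylWord_jcWord _ hh).continuousOn).eLpNorm_ne_top
  simp only [hterm]
  rw [ENNReal.toReal_sum fun m _ => ENNReal.sum_ne_top.2 fun w _ => hfin m w]
  refine Finset.sum_congr rfl fun m _ => ?_
  rw [ENNReal.toReal_sum fun w _ => hfin m w]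
  rfl

end WordSum

/-! ### Expanding a letter in the basis -/

/-- **A derivation within expands pointwise in the basis**:
`∂_X g (x) = Σ_k ℓ_k(X x) ∂_{e_k} g (x)`, `ℓ_k` the coordinate functionals of the basis `e`. [folklore] -/
theorem cylDeriv_eq_sum_coord_mul (b : Module.Basis (Fin (Module.finrank ℝ ℝ³)) ℝ ℝ³) (V : ℝ³ → ℝ³)
    (g : ℝ³ → F) (x : ℝ³) :
    cylDeriv V g x = ∑ k, b.coord k (V x) • cylDeriv (fun _ => b k) g x := by
  simp only [cylDeriv_apply]
  conv_lhs => rw [← b.sum_repr (V x)]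
  rw [map_sum]
  simp only [map_smul, Module.Basis.coord_apply]

/-- The pointwise bound that goes with it: `‖∂_X g (x)‖ ≤ Σ_k ‖ℓ_k‖ ‖X x‖ ‖∂_{e_k} g (x)‖`. [folklore] -/
theorem norm_cylDeriv_le_sum_coord (b : Module.Basis (Fin (Module.finrank ℝ ℝ³)) ℝ ℝ³) (V : ℝ³ → ℝ³)
    (g : ℝ³ → F) (x : ℝ³) :
    ‖cylDeriv V g x‖ ≤ ∑ k, ‖LinearMap.toContinuousLinearMap (b.coord k)‖ * ‖V x‖ *
      ‖cylDeriv (fun _ => b k) g x‖ := by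
  rw [cylDeriv_eq_sum_coord_mul b V g x]
  refine (norm_sum_le _ _).trans (Finset.sum_le_sum fun k _ => ?_)
  rw [norm_smul]
  refine mul_le_mul_of_nonneg_right ?_ (norm_nonneg _)
  exact (LinearMap.toContinuousLinearMap (b.coord k)).le_opNorm (V x)

/-! ### Small `cellL2` bookkeeping -/

section CellL2

variable {F' : Type*} [NormedAddCommGroup F'] [NormedSpace ℝ F']

omit [NormedSpace ℝ F'] in
/-- `cellL2 ‖f‖ = cellL2 f`. [folklore] -/
theorem cellL2_norm (L : ℝ) (f : ℝ³ → F') : cellL2 L (fun x => ‖f x‖) = cellL2 L f := by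
  rw [cellL2, cellL2, eLpNorm_norm]

omit [NormedSpace ℝ F'] in
/-- **Triangle inequality for finite sums** of functions continuous on the closed cylinder. [folklore] -/
theorem cellL2_sum_le {ι' : Type*} (L : ℝ) (s : Finset ι') {f : ι' → ℝ³ → F'}
    (hf : ∀ i ∈ s, ContinuousOn (f i) 𝕂) :
    cellL2 L (fun x => ∑ i ∈ s, f i x) ≤ ∑ i ∈ s, cellL2 L (f i) := by
  classical
  induction s using Finset.induction_on with
  | empty => simp [cellL2]
  | insert a s ha ih =>
    have hfa : ContinuousOn (f a) 𝕂 := hf a (Finset.mem_insert_self a s)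
    have hfs : ∀ i ∈ s, ContinuousOn (f i) 𝕂 := fun i hi => hf i (Finset.mem_insert_of_mem hi)
    simp only [Finset.sum_insert ha]
    exact (cellL2_add_le L hfa (continuousOn_finsetSum s hfs)).trans (add_le_add le_rfl (ih hfs))

/-- `cellL2 (c f) = c cellL2 f` for `c ≥ 0` and real `f`. [folklore] -/
theorem cellL2_const_mul (L : ℝ) {c : ℝ} (hc : 0 ≤ c) (f : ℝ³ → ℝ) :
    cellL2 L (fun x => c * f x) = c * cellL2 L f := by
  have h := cellL2_const_smul L c f
  simp only [smul_eq_mul] at h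
  rw [h, abs_of_nonneg hc]

end CellL2

/-- `‖J v‖ ≤ ‖v‖` (the generator forgets the axial component and rotates the rest). [folklore] -/
theorem norm_rotGen_le_norm (v : ℝ³) : ‖rotGen v‖ ≤ ‖v‖ := by
  rw [norm_rotGen, EuclideanSpace.norm_eq, Fin.sum_univ_three]
  refine Real.sqrt_le_sqrt ?_
  simp only [Real.norm_eq_abs, sq_abs]
  nlinarith [sq_nonneg (v 2)]

/-! ### Pushing a constant derivative inside a word -/

/-- `∂_V` of a conditional term. [folklore] -/
theorem cylDeriv_bif (c : Bool) (V : ℝ³ → ℝ³) (A : ℝ³ → F) (x : ℝ³) :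
    cylDeriv V (fun y => bif c then A y else 0) x = (bif c then cylDeriv V A x else 0) := by
  cases c
  · simp only [cond_false]
    exact cylDeriv_const (V := V) (0 : F) x
  · rfl

/-- Smoothness of a conditional term. [folklore] -/
theorem contDiffOn_bif (c : Bool) {A : ℝ³ → F} (hA : ContDiffOn ℝ ∞ A 𝕂) :
    ContDiffOn ℝ ∞ (fun y => bif c then A y else (0 : F)) 𝕂 := by
  cases c
  · exact contDiffOn_const
  · exact hA

/-- **The commutator of a constant derivative with a letter**: `∂_w ∂_J f = ∂_J ∂_w f + ∂_{Jw} f` and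
`∂_w ∂_v f = ∂_v ∂_w f` on the closed cylinder. [folklore] -/
theorem cylDeriv_const_jcField (w : ℝ³) : ∀ (Y : Option ℝ³) {f : ℝ³ → F}, ContDiffOn ℝ ∞ f 𝕂 →
    ∀ {x : ℝ³}, x ∈ 𝕂 →
      cylDeriv (fun _ => w) (cylDeriv (jcField Y) f) x =
        cylDeriv (jcField Y) (cylDeriv (fun _ => w) f) x +
          (bif Y.isNone then cylDeriv (fun _ => rotGen w) f x else 0)
  | none, f, hf, x, hx => by
    have h := cylDeriv_comm_sub (V := fun _ => w) (W := rotGen) (differentiableAt_const w)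
      (hasFDerivAt_rotGen x).differentiableAt hf hx
    have hfield : (fun y : ℝ³ => fderiv ℝ rotGen y w - fderiv ℝ (fun _ : ℝ³ => w) y (rotGen y)) =
        fun _ => rotGen w := by
      funext y
      rw [fderiv_rotGen, fderiv_fun_const]
      simp
    rw [hfield] at h
    simp only [jcField_none, Option.isNone_none, cond_true]
    rw [← h]
    abel
  | some v, f, hf, x, hx => by
    have h := cylDeriv_comm_sub (V := fun _ => w) (W := fun _ => v) (differentiableAt_const w)
      (differentiableAt_const v) hf hx
    have hfield : (fun y : ℝ³ => fderiv ℝ (fun _ : ℝ³ => v) y w - fderiv ℝ (fun _ : ℝ³ => w) y v) =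
        fun _ => (0 : ℝ³) := by
      funext y
      simp [fderiv_fun_const]
    rw [hfield] at h
    have h0 : cylDeriv (fun _ : ℝ³ => (0 : ℝ³)) f x = 0 := by simp [cylDeriv_apply]
    rw [h0, sub_eq_zero] at h
    simp only [jcField_some, Option.isNone_some, cond_false, add_zero]
    exact h

/-- The indicator of the positions of a word holding the letter `J`. [folklore] -/
theorem isJ_cons_zero (Y : Option ℝ³) (wd : List (Option ℝ³)) :
    ((Y :: wd)[0]?).elim false Option.isNone = Y.isNone := rfl

/-- The indicator of the `J`-positions, shifted. [folklore] -/
theorem isJ_cons_succ (Y : Option ℝ³) (wd : List (Option ℝ³)) (i : ℕ) :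
    ((Y :: wd)[i + 1]?).elim false Option.isNone = (wd[i]?).elim false Option.isNone := by
  simp

/-- **A constant derivative pushed inside a word over `{J} ∪ {constants}`**: on the closed cylinder,
`∂_w (X₁⋯X_n g) = X₁⋯X_n (∂_w g) + Σ_{i : Xᵢ = J} X₁⋯X_{i−1} ∂_{Jw} X_{i+1}⋯X_n g`
(each `J` in turn replaced by the constant letter `Jw`, from `[∂_w, J] = ∂_{Jw}`, `[∂_w, ∂_v] = 0`).
[folklore] -/
theorem cylDeriv_const_cylWord_jcWord (w : ℝ³) : ∀ (wd : List (Option ℝ³)) {g : ℝ³ → F},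
    ContDiffOn ℝ ∞ g 𝕂 →
      EqOn (cylDeriv (fun _ => w) (cylWord (jcWord wd) g))
        (fun x => cylWord (jcWord wd) (cylDeriv (fun _ => w) g) x +
          ∑ i ∈ Finset.range wd.length,
            (bif (wd[i]?).elim false Option.isNone then
              cylWord (jcWord (wd.set i (some (rotGen w)))) g x else 0)) 𝕂
  | [], g, _ => by
    intro x _
    simp [jcWord_nil]
  | Y :: wd, g, hg => by
    intro x hx
    have hW : ContDiffOn ℝ ∞ (cylWord (jcWord wd) g) 𝕂 := contDiffOn_cylWord_jcWord wd hg
    have hwg : ContDiffOn ℝ ∞ (cylDeriv (fun _ => w) g) 𝕂 := contDiffOn_cylDeriv contDiff_const hg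
    -- the commutator with the outermost letter
    rw [jcWord_cons, cylWord_cons, cylDeriv_const_jcField w Y hW hx]
    -- the induction hypothesis inside
    have ih := cylDeriv_const_cylWord_jcWord w wd hg
    rw [cylDeriv_congr ih hx]
    -- smoothness of the summands
    have hterm : ∀ i ∈ Finset.range wd.length, ContDiffOn ℝ ∞ (fun y =>
        bif (wd[i]?).elim false Option.isNone then
          cylWord (jcWord (wd.set i (some (rotGen w)))) g y else (0 : F)) 𝕂 := fun i _ =>
      contDiffOn_bif _ (contDiffOn_cylWord_jcWord _ hg)
    have hA : ContDiffOn ℝ ∞ (cylWord (jcWord wd) (cylDeriv (fun _ => w) g)) 𝕂 :=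
      contDiffOn_cylWord_jcWord wd hwg
    have hS : ContDiffOn ℝ ∞ (fun y => ∑ i ∈ Finset.range wd.length,
        (bif (wd[i]?).elim false Option.isNone then
          cylWord (jcWord (wd.set i (some (rotGen w)))) g y else (0 : F))) 𝕂 :=
      ContDiffOn.sum hterm
    rw [cylDeriv_add hA hS hx, cylDeriv_finset_sum (Finset.range wd.length) hterm hx]
    simp only [cylDeriv_bif]
    -- the right-hand side for the longer word
    rw [cylWord_cons, List.length_cons, Finset.sum_range_succ']
    simp only [isJ_cons_zero, isJ_cons_succ, List.set_cons_zero, List.set_cons_succ, jcWord_cons,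
      cylWord_cons, jcField_some]
    abel

/-! ### The main bound -/

section Main

/-- One more innermost constant letter is one more letter of the word of constants:
`X_{e∘w} (∂_{e_k} g) = X_{e ∘ cons k w} g`. [folklore] -/
theorem cylWord_constWord_cylDeriv (b : Module.Basis (Fin (Module.finrank ℝ ℝ³)) ℝ ℝ³) {m : ℕ}
    (w : Fin m → Fin (Module.finrank ℝ ℝ³)) (k : Fin (Module.finrank ℝ ℝ³)) (g : ℝ³ → F) :
    cylWord (jcWord (constWord fun j => b (w j))) (cylDeriv (fun _ => b k) g) =
      cylWord (jcWord (constWord fun j => b ((Fin.cons k w : Fin (m + 1) → _) j))) g := by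
  have hc : (fun j => b ((Fin.cons k w : Fin (m + 1) → _) j)) = Fin.cons (b k) (fun j => b (w j)) := by
    funext j
    refine Fin.cases ?_ (fun i => ?_) j
    · simp
    · simp
  rw [hc, constWord_cons, jcWord_append, cylWord_append]
  rfl

/-- **Words over `{J} ∪ {constants}` are controlled by the word sum of the Sobolev norm.** Let
`e = Module.finBasis ℝ ℝ³`, `M ≥ 1` with `‖e_k‖ ≤ M`. For every `n` there is `K ≥ 0` such that for
every word `X₁⋯X_n` of length `n` over the alphabet `{J} ∪ {∂_v : ‖v‖ ≤ M}` and every `g` smooth on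
the closed cylinder,
`cellL2 (X₁⋯X_n g) ≤ K Mⁿ Σ_{m ≤ n} Σ_{w : Fin m → ι} cellL2 (X_{e∘w} g)`
(the right-hand sum is `‖g‖_{W^{n,2}(cell)}`, `toReal_eSobolevDomainNorm_eq_wordSum`). Induction on `n`:
expand the outermost letter in the basis (`norm_cylDeriv_le_sum_coord`, `‖X x‖ ≤ M` on `{r ≤ 1}`),
push the constant derivative inside (`cylDeriv_const_cylWord_jcWord`: the `≤ n` commutator words have
length `n` and letters bounded by `M` again, `‖Je_k‖ ≤ ‖e_k‖ ≤ M`), and apply the induction hypothesis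
to `∂_{e_k} g` and to `g`; `K_{n+1} = (Σ_k ‖ℓ_k‖)(n + 1) K_n`. [folklore] -/
theorem exists_cellL2_cylWord_jcWord_le (L : ℝ) {M : ℝ} (hM1 : 1 ≤ M)
    (hMb : ∀ k, ‖Module.finBasis ℝ ℝ³ k‖ ≤ M) :
    ∀ n : ℕ, ∃ K : ℝ, 0 ≤ K ∧ ∀ (wd : List (Option ℝ³)), wd.length = n →
      (∀ v, some v ∈ wd → ‖v‖ ≤ M) → ∀ (g : ℝ³ → F), ContDiffOn ℝ ∞ g 𝕂 →
        cellL2 L (cylWord (jcWord wd) g) ≤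
          K * M ^ n * ∑ m ∈ Finset.range (n + 1), ∑ w : Fin m → Fin (Module.finrank ℝ ℝ³),
            cellL2 L (cylWord (jcWord (constWord fun j => Module.finBasis ℝ ℝ³ (w j))) g) := by
  set ι := Fin (Module.finrank ℝ ℝ³) with hι
  set b : Module.Basis ι ℝ ℝ³ := Module.finBasis ℝ ℝ³ with hb
  set ℓ : ι → (ℝ³ →L[ℝ] ℝ) := fun k => LinearMap.toContinuousLinearMap (b.coord k) with hℓ
  set Λ : ℝ := ∑ k, ‖ℓ k‖ with hΛ
  have hΛ0 : 0 ≤ Λ := Finset.sum_nonneg fun k _ => norm_nonneg _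
  have hM0 : 0 ≤ M := zero_le_one.trans hM1
  -- the word sum and its two monotonicity properties
  set 𝒩 : ℕ → (ℝ³ → F) → ℝ := fun n g => ∑ m ∈ Finset.range (n + 1), ∑ w : Fin m → ι,
    cellL2 L (cylWord (jcWord (constWord fun j => b (w j))) g) with h𝒩
  have h𝒩0 : ∀ n g, 0 ≤ 𝒩 n g := fun n g =>
    Finset.sum_nonneg fun m _ => Finset.sum_nonneg fun w _ => cellL2_nonneg L _
  have h𝒩mono : ∀ n g, 𝒩 n g ≤ 𝒩 (n + 1) g := fun n g => by
    simp only [h𝒩]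
    rw [Finset.sum_range_succ _ (n + 1)]
    exact le_add_of_nonneg_right (Finset.sum_nonneg fun w _ => cellL2_nonneg L _)
  have h𝒩deriv : ∀ n g (k : ι), 𝒩 n (cylDeriv (fun _ => b k) g) ≤ 𝒩 (n + 1) g := by
    intro n g k
    simp only [h𝒩]
    calc ∑ m ∈ Finset.range (n + 1), ∑ w : Fin m → ι,
          cellL2 L (cylWord (jcWord (constWord fun j => b (w j))) (cylDeriv (fun _ => b k) g))
        = ∑ m ∈ Finset.range (n + 1), ∑ w : Fin m → ι,
            cellL2 L (cylWord (jcWord (constWord fun j => b ((Fin.cons k w : Fin (m + 1) → ι) j))) g) := by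
          simp only [cylWord_constWord_cylDeriv]
      _ ≤ ∑ m ∈ Finset.range (n + 1), ∑ w' : Fin (m + 1) → ι,
            cellL2 L (cylWord (jcWord (constWord fun j => b (w' j))) g) := by
          refine Finset.sum_le_sum fun m _ => ?_
          rw [sum_fin_succ_fun]
          exact Finset.single_le_sum (f := fun k' : ι => ∑ w : Fin m → ι,
            cellL2 L (cylWord (jcWord (constWord fun j => b ((Fin.cons k' w : Fin (m + 1) → ι) j))) g))
            (fun _ _ => Finset.sum_nonneg fun w _ => cellL2_nonneg L _) (Finset.mem_univ k)
      _ ≤ ∑ m ∈ Finset.range (n + 1 + 1), ∑ w : Fin m → ι,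
            cellL2 L (cylWord (jcWord (constWord fun j => b (w j))) g) := by
          rw [Finset.sum_range_succ' _ (n + 1)]
          exact le_add_of_nonneg_right (Finset.sum_nonneg fun w _ => cellL2_nonneg L _)
  -- induction on the length
  intro n
  induction n with
  | zero =>
    refine ⟨1, zero_le_one, fun wd hwd _ g _ => ?_⟩
    have hnil : wd = [] := List.eq_nil_of_length_eq_zero hwd
    subst hnil
    simp only [jcWord_nil, cylWord_nil, pow_zero, one_mul, zero_add, Finset.range_one, Finset.sum_singleton]
    rw [sum_fin_zero_fun, constWord_zero, jcWord_nil, cylWord_nil]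
  | succ n ih =>
    obtain ⟨K, hK0, hK⟩ := ih
    refine ⟨Λ * (n + 1) * K, by positivity, fun wd hwd hletters g hg => ?_⟩
    obtain ⟨X, wd', rfl⟩ := List.exists_of_length_succ wd hwd
    have hwd' : wd'.length = n := by simpa using hwd
    have hX : ∀ v, X = some v → ‖v‖ ≤ M := fun v hv => hletters v (by rw [hv]; exact List.mem_cons_self ..)
    have hletters' : ∀ v, some v ∈ wd' → ‖v‖ ≤ M := fun v hv => hletters v (List.mem_cons_of_mem _ hv)
    -- the inner word and its constant derivatives
    set G : ℝ³ → F := cylWord (jcWord wd') g with hG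
    have hGs : ContDiffOn ℝ ∞ G 𝕂 := contDiffOn_cylWord_jcWord wd' hg
    have hDk : ∀ k, ContDiffOn ℝ ∞ (cylDeriv (fun _ => b k) G) 𝕂 := fun k => contDiffOn_cylDeriv contDiff_const hGs
    -- step 1: expand the outermost letter
    have step1 : cellL2 L (cylWord (jcWord (X :: wd')) g) ≤
        ∑ k, ‖ℓ k‖ * M * cellL2 L (cylDeriv (fun _ => b k) G) := by
      rw [jcWord_cons, cylWord_cons]
      have hpt : ∀ x ∈ (cylinderCell L : Set ℝ³), ‖cylDeriv (jcField X) G x‖ ≤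
          ‖∑ k, ‖ℓ k‖ * M * ‖cylDeriv (fun _ => b k) G x‖‖ := by
        intro x hx
        have hxK : x ∈ 𝕂 := subset_closure (cylinderCell_le_unitCylinder L hx)
        have hnn : 0 ≤ ∑ k, ‖ℓ k‖ * M * ‖cylDeriv (fun _ => b k) G x‖ :=
          Finset.sum_nonneg fun k _ => by positivity
        rw [Real.norm_of_nonneg hnn]
        refine (norm_cylDeriv_le_sum_coord b (jcField X) G x).trans (Finset.sum_le_sum fun k _ => ?_)
        have h1 : ‖jcField X x‖ ≤ M := norm_jcField_le hM1 hX hxK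
        have h2 : 0 ≤ ‖LinearMap.toContinuousLinearMap (b.coord k)‖ := norm_nonneg _
        calc ‖LinearMap.toContinuousLinearMap (b.coord k)‖ * ‖jcField X x‖ * ‖cylDeriv (fun _ => b k) G x‖
            ≤ ‖LinearMap.toContinuousLinearMap (b.coord k)‖ * M * ‖cylDeriv (fun _ => b k) G x‖ := by
              gcongr
          _ = ‖ℓ k‖ * M * ‖cylDeriv (fun _ => b k) G x‖ := rfl
      have hcont : ContinuousOn (fun x => ∑ k, ‖ℓ k‖ * M * ‖cylDeriv (fun _ => b k) G x‖) 𝕂 :=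
        continuousOn_finsetSum _ fun k _ => continuousOn_const.mul (hDk k).continuousOn.norm
      calc cellL2 L (cylDeriv (jcField X) G) ≤ cellL2 L (fun x => ∑ k, ‖ℓ k‖ * M * ‖cylDeriv (fun _ => b k) G x‖) :=
            cellL2_mono L hcont hpt
        _ ≤ ∑ k, cellL2 L (fun x => ‖ℓ k‖ * M * ‖cylDeriv (fun _ => b k) G x‖) :=
            cellL2_sum_le L _ fun k _ => continuousOn_const.mul (hDk k).continuousOn.norm
        _ = ∑ k, ‖ℓ k‖ * M * cellL2 L (cylDeriv (fun _ => b k) G) := by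
            refine Finset.sum_congr rfl fun k _ => ?_
            rw [cellL2_const_mul L (by positivity), cellL2_norm]
    -- step 2: push `∂_{e_k}` inside the inner word
    have step2 : ∀ k, cellL2 L (cylDeriv (fun _ => b k) G) ≤ (n + 1) * K * M ^ n * 𝒩 (n + 1) g := by
      intro k
      have hid := cylDeriv_const_cylWord_jcWord (F := F) (b k) wd' hg
      -- the main term
      have hmain : cellL2 L (cylWord (jcWord wd') (cylDeriv (fun _ => b k) g)) ≤ K * M ^ n * 𝒩 (n + 1) g := by
        have h := hK wd' hwd' hletters' (cylDeriv (fun _ => b k) g) (contDiffOn_cylDeriv contDiff_const hg)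
        refine h.trans ?_
        exact mul_le_mul_of_nonneg_left (h𝒩deriv n g k) (by positivity)
      -- the commutator terms
      have hcomm : ∀ i ∈ Finset.range wd'.length, cellL2 L (fun x =>
          bif (wd'[i]?).elim false Option.isNone then
            cylWord (jcWord (wd'.set i (some (rotGen (b k))))) g x else (0 : F)) ≤
          K * M ^ n * 𝒩 (n + 1) g := by
        intro i _
        cases (wd'[i]?).elim false Option.isNone with
        | false =>
          simp only [cond_false]
          have : cellL2 L (fun _ : ℝ³ => (0 : F)) = 0 := by simp [cellL2]
          rw [this]
          exact mul_nonneg (by positivity) (h𝒩0 _ _)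
        | true =>
          simp only [cond_true]
          have hlen : (wd'.set i (some (rotGen (b k)))).length = n := by rw [List.length_set, hwd']
          have hlet : ∀ v, some v ∈ wd'.set i (some (rotGen (b k))) → ‖v‖ ≤ M := by
            intro v hv
            rcases List.mem_or_eq_of_mem_set hv with h | h
            · exact hletters' v h
            · rw [Option.some.injEq] at h
              rw [h]
              exact (norm_rotGen_le_norm _).trans (hMb k)
          have h := hK _ hlen hlet g hg
          refine h.trans ?_
          exact mul_le_mul_of_nonneg_left (h𝒩mono n g) (by positivity)
      -- combine
      have hterm_cont : ∀ i ∈ Finset.range wd'.length, ContinuousOn (fun x =>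
          bif (wd'[i]?).elim false Option.isNone then
            cylWord (jcWord (wd'.set i (some (rotGen (b k))))) g x else (0 : F)) 𝕂 := fun i _ =>
        (contDiffOn_bif _ (contDiffOn_cylWord_jcWord _ hg)).continuousOn
      have hAc : ContinuousOn (cylWord (jcWord wd') (cylDeriv (fun _ => b k) g)) 𝕂 :=
        (contDiffOn_cylWord_jcWord wd' (contDiffOn_cylDeriv contDiff_const hg)).continuousOn
      have hSc : ContinuousOn (fun x => ∑ i ∈ Finset.range wd'.length,
          (bif (wd'[i]?).elim false Option.isNone then
            cylWord (jcWord (wd'.set i (some (rotGen (b k))))) g x else (0 : F))) 𝕂 :=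
        continuousOn_finsetSum _ hterm_cont
      have e1 : cellL2 L (cylDeriv (fun _ => b k) G) = cellL2 L (fun x =>
          cylWord (jcWord wd') (cylDeriv (fun _ => b k) g) x +
            ∑ i ∈ Finset.range wd'.length,
              (bif (wd'[i]?).elim false Option.isNone then
                cylWord (jcWord (wd'.set i (some (rotGen (b k))))) g x else 0)) := by
        simp only [cellL2]
        congr 1
        exact eLpNorm_congr_ae (ae_restrict_of_forall_mem (cylinderCell L).isOpen.measurableSet
          fun x hx => hid (subset_closure (cylinderCell_le_unitCylinder L hx)))
      rw [e1]
      calc _ ≤ cellL2 L (cylWord (jcWord wd') (cylDeriv (fun _ => b k) g)) +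
            cellL2 L (fun x => ∑ i ∈ Finset.range wd'.length,
              (bif (wd'[i]?).elim false Option.isNone then
                cylWord (jcWord (wd'.set i (some (rotGen (b k))))) g x else (0 : F))) :=
            cellL2_add_le L hAc hSc
        _ ≤ K * M ^ n * 𝒩 (n + 1) g + ∑ i ∈ Finset.range wd'.length, K * M ^ n * 𝒩 (n + 1) g :=
            add_le_add hmain ((cellL2_sum_le L _ hterm_cont).trans (Finset.sum_le_sum hcomm))
        _ = (n + 1) * K * M ^ n * 𝒩 (n + 1) g := by
            rw [Finset.sum_const, Finset.card_range, hwd', nsmul_eq_mul]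
            ring
    -- combine the two steps
    calc cellL2 L (cylWord (jcWord (X :: wd')) g)
        ≤ ∑ k, ‖ℓ k‖ * M * cellL2 L (cylDeriv (fun _ => b k) G) := step1
      _ ≤ ∑ k, ‖ℓ k‖ * M * ((n + 1) * K * M ^ n * 𝒩 (n + 1) g) :=
          Finset.sum_le_sum fun k _ => mul_le_mul_of_nonneg_left (step2 k) (by positivity)
      _ = Λ * (n + 1) * K * M ^ (n + 1) * 𝒩 (n + 1) g := by
          rw [← Finset.sum_mul, ← Finset.sum_mul, ← hΛ]
          ring

end Main

end Literature.Analysis.FluidPDE
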